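import Literature.Analysis.FluidPDE.FluidComputer.SpaceGroupSymmetry
import Literature.Analysis.FluidPDE.FluidComputer.PointGroupMasks
import HarnessLib

/-!
# The `4₃` screw and the diagonal dyad acting on Galerkin velocity fields: persistence, invariant diagnostics,
# and the selection rules on the screw axis

HONEST FRAMING (cell `pub-fluidc`, verbatim): *low prior, high value-of-information experiment on Tao's machine
paradigm; NOT a claim that NS blows up.* Everything below concerns the finite Galerkin system on a mode set `S ⊂ ℤ³`
that both engines of the cell integrate; nothing concerns the Navier–Stokes PDE.

Paper §G.6 (GADGETS lane; `gadgets.symm`, the `screw` family and the reserved key `sym`): the generators of the chiral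
order-8 screw group `P4₃2₁2(y)` of the box `[0, 2π)³` are the `4₃` SCREW `A : x ↦ P_A x + a`, `P_A (x, y, z) = (z, y, −x)`
(the quarter turn about `+y`), `a = 2π (½, ¾, ½) = (π, 3π/2, π)`, and the DYAD `B : x ↦ P_B x`, `P_B (x, y, z) = (z, −y, x)`
(the half turn about `[1, 0, 1]`); every element is a word in `A`, `B` (`ChiralScrewGroup`: `[1, A², A, A³, AB, A³B, B,
A²B]`). In Fourier space they act by `û(k) ↦ e^{−ik·a} P û(Pᵀk)` — the package's `(g u)^(n) = e^{−2πi n·t} P û(Pᵀn)`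
with `a = 2πt` — which is EXACTLY `LatticeIsometry.sg` / `LatticeIsometry.act` of the Literature side. This file types:

* `isoA`, `isoB : LatticeIsometry`, `transA = (π, 3π/2, π)`, **`screw43 = isoA.sg transA`**, **`dyad101 = isoB.act`**;
  their coefficient formulas (`screw43_coeff`, `dyad101_coeff`).
* **PERSISTENCE** ("a `G`-invariant datum stays `G`-invariant for all time", §G.6 'why this is a mechanism axis'): an
  unforced Galerkin solution on a mode set mapped into itself by `P_A`, `P_Aᵀ` (resp. `P_B`) whose datum is fixed by
  `screw43` (resp. `dyad101`) at one time is fixed at every time — `screw43_persists`, `dyad101_persists` — and on the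
  engines' cubic mask `Dealiasing.box K` with NO side condition (`screw43_persists_box`, `dyad101_persists_box`); fixed
  by both generators ⇒ fixed by every word (`fixed_words`), i.e. by the whole group.
* INVARIANT DIAGNOSTICS: `E_S`, `Z_S` are unchanged by `screw43` and `dyad101` (`truncEnergy_screw43`, …).
* **SELECTION RULES ON THE SCREW AXIS** (new; an exact, sign-definite diagnostic for every `screw` / `sym`-`P4₃2₁2` run and
  for the opt-bounds optimum up to its measured defect). On the axis line `k = (0, k₁, 0)` one has `P_Aᵀk = k` and
  `e^{−ik·a} = e^{−3πik₁/2} = i^{k₁}`, so a `screw43`-invariant field satisfies `û₀ = i^{k₁} û₂`, `û₂ = −i^{k₁} û₀`: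
  - `k₁` even, `k₁ ≠ 0`: **`û(0, k₁, 0) = 0`** (`axis_even`); `k = 0`: `û₀ = û₂ = 0` — a mean flow only ALONG the screw
    axis (`axis_zero`; the dyad `B` of the full group removes that too: `mean_zero`);
  - `k₁ ≡ 1 (mod 4)`: `û₁ = 0`, **`û₂ = −i û₀`**; `k₁ ≡ 3 (mod 4)`: `û₁ = 0`, **`û₂ = +i û₀`** (`axis_one_mod_four`,
    `axis_three_mod_four`): every surviving axis mode is a PURE HELICAL WAVE, and its modal helicity SATURATES the
    realizability bound `|H(k)| ≤ 2|k|E(k)` (`abs_modalHelicity_le`) with a definite sign —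
    **`H(0,k₁,0) = +2k₁E`** for `k₁ ≡ 1`, **`= −2k₁E`** for `k₁ ≡ 3 (mod 4)` (`axis_helicity_one_mod_four`,
    `axis_helicity_three_mod_four`); along a Galerkin solution with `screw43`-invariant datum this holds at every time
    (`axis_even_along`, …). For the enantiomorph `4₁` (`a' = (π, π/2, π)`) the two signs swap (companion file).

NOT CLAIMED: that any particular datum is invariant (the optimum's invariance is a measured defect `≤ 0.042`, §O.5);
anything about round-off or dynamics beyond persistence. 0 sorry, 0 named facts (D-0026). [folklore]
-/

noncomputable section

namespace Summit.NavierStokesRegularity.FluidComputer.ChiralScrewGroupAction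

open Literature.Analysis.FluidPDE.FluidComputer
open Literature.Analysis.FluidPDE.FluidComputer.ShellTransfer
open Complex ComplexConjugate

/-! ## The two generators as lattice isometries, and their Fourier-space actions -/

/-- `P_A (x, y, z) = (z, y, −x)`: the quarter turn about `+y` (rotation part of the `4₃` screw `A`). [folklore] -/
def isoA : LatticeIsometry where
  M := ![![0, 0, 1], ![0, 1, 0], ![-1, 0, 0]]
  orth_col j l := by
    fin_cases j <;> fin_cases l <;> simp [Fin.sum_univ_three]
  orth_row j l := by
    fin_cases j <;> fin_cases l <;> simp [Fin.sum_univ_three]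

/-- `P_B (x, y, z) = (z, −y, x)`: the half turn about the diagonal `[1, 0, 1]` (the dyad `B`). [folklore] -/
def isoB : LatticeIsometry where
  M := ![![0, 0, 1], ![0, -1, 0], ![1, 0, 0]]
  orth_col j l := by
    fin_cases j <;> fin_cases l <;> simp [Fin.sum_univ_three]
  orth_row j l := by
    fin_cases j <;> fin_cases l <;> simp [Fin.sum_univ_three]

/-- The screw translation `a = 2π (½, ¾, ½) = (π, 3π/2, π)` of `A` (box period `2π`). [folklore] -/
def transA : Fin 3 → ℝ := ![Real.pi, 3 * Real.pi / 2, Real.pi]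

/-- **The `4₃` screw `A` acting on Fourier velocity fields**: `û(k) ↦ e^{−ik·a} P_A û(P_Aᵀk)`. [folklore] -/
def screw43 (X : FourierVelocity) : FourierVelocity := isoA.sg transA X

/-- **The dyad `B` acting on Fourier velocity fields**: `û(k) ↦ P_B û(P_Bᵀk)`. [folklore] -/
def dyad101 (X : FourierVelocity) : FourierVelocity := isoB.act X

/-- `P_Aᵀ k = (−k₂, k₁, k₀)`. [folklore] -/
theorem isoA_invK (k : Fin 3 → ℤ) : isoA.invK k = ![-k 2, k 1, k 0] := by
  funext i
  unfold LatticeIsometry.invK isoA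
  fin_cases i <;> simp [Fin.sum_univ_three]

/-- `P_A k = (k₂, k₁, −k₀)`. [folklore] -/
theorem isoA_actK (k : Fin 3 → ℤ) : isoA.actK k = ![k 2, k 1, -k 0] := by
  funext i
  unfold LatticeIsometry.actK isoA
  fin_cases i <;> simp [Fin.sum_univ_three]

/-- `P_Bᵀ k = (k₂, −k₁, k₀)` (`P_B` is symmetric). [folklore] -/
theorem isoB_invK (k : Fin 3 → ℤ) : isoB.invK k = ![k 2, -k 1, k 0] := by
  funext i
  unfold LatticeIsometry.invK isoB
  fin_cases i <;> simp [Fin.sum_univ_three]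

/-- **Coefficients of `screw43 X`**: `e^{−ik·a} (û₂, û₁, −û₀)(P_Aᵀk)`. [folklore] -/
theorem screw43_coeff (X : FourierVelocity) (k : Fin 3 → ℤ) :
    (screw43 X).coeff k = fun i => phase transA k *
      ![X.coeff (isoA.invK k) 2, X.coeff (isoA.invK k) 1, -X.coeff (isoA.invK k) 0] i := by
  funext i
  show phase transA k * (isoA.act X).coeff k i = _
  rw [LatticeIsometry.act_coeff]
  unfold isoA
  fin_cases i <;> simp [Fin.sum_univ_three]

/-- **Coefficients of `dyad101 X`**: `(û₂, −û₁, û₀)(P_Bᵀk)`. [folklore] -/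
theorem dyad101_coeff (X : FourierVelocity) (k : Fin 3 → ℤ) :
    (dyad101 X).coeff k = ![X.coeff (isoB.invK k) 2, -X.coeff (isoB.invK k) 1, X.coeff (isoB.invK k) 0] := by
  funext i
  show (isoB.act X).coeff k i = _
  rw [LatticeIsometry.act_coeff]
  unfold isoB
  fin_cases i <;> simp [Fin.sum_univ_three]

/-! ## Persistence along unforced Galerkin solutions -/

/-- **PERSISTENCE OF THE `4₃` SCREW SYMMETRY**: an unforced Galerkin solution (any `ν`, any pressure multiplier) supported
in a mode set mapped into itself by `P_A` and `P_Aᵀ`, whose datum is `screw43`-invariant at one time, is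
`screw43`-invariant at every time. [folklore] -/
theorem screw43_persists {U : ℝ → FourierVelocity} {S : Finset (Fin 3 → ℤ)} {ν : ℝ} {c : ℝ → (Fin 3 → ℤ) → ℂ}
    (hU : IsGalerkinSolution U S ν c fun _ _ _ => 0) (hs : IsSupportedOn U S) (hS : ∀ p ∈ S, isoA.invK p ∈ S)
    (hS' : ∀ p ∈ S, isoA.actK p ∈ S) {t₀ : ℝ} (h0 : screw43 (U t₀) = U t₀) (t : ℝ) : screw43 (U t) = U t :=
  isoA.sg_eq_self hU hs hS hS' transA h0 t

/-- … on the engines' cubic mask `{|kᵢ| ≤ K}`, with NO side condition. [folklore] -/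
theorem screw43_persists_box {K : ℕ} {U : ℝ → FourierVelocity} {ν : ℝ} {c : ℝ → (Fin 3 → ℤ) → ℂ}
    (hU : IsGalerkinSolution U (Dealiasing.box K) ν c fun _ _ _ => 0) (hs : IsSupportedOn U (Dealiasing.box K))
    {t₀ : ℝ} (h0 : screw43 (U t₀) = U t₀) (t : ℝ) : screw43 (U t) = U t :=
  isoA.sg_eq_self hU hs (fun _ hp => isoA.invK_mem_box hp) (fun _ hp => isoA.actK_mem_box hp) transA h0 t

/-- **PERSISTENCE OF THE DYAD SYMMETRY.** [folklore] -/
theorem dyad101_persists {U : ℝ → FourierVelocity} {S : Finset (Fin 3 → ℤ)} {ν : ℝ} {c : ℝ → (Fin 3 → ℤ) → ℂ}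
    (hU : IsGalerkinSolution U S ν c fun _ _ _ => 0) (hs : IsSupportedOn U S) (hS : ∀ p ∈ S, isoB.invK p ∈ S)
    (hS' : ∀ p ∈ S, isoB.actK p ∈ S) {t₀ : ℝ} (h0 : dyad101 (U t₀) = U t₀) (t : ℝ) : dyad101 (U t) = U t :=
  isoB.act_eq_self hU hs hS hS' h0 t

/-- … on the engines' cubic mask, no side condition. [folklore] -/
theorem dyad101_persists_box {K : ℕ} {U : ℝ → FourierVelocity} {ν : ℝ} {c : ℝ → (Fin 3 → ℤ) → ℂ}
    (hU : IsGalerkinSolution U (Dealiasing.box K) ν c fun _ _ _ => 0) (hs : IsSupportedOn U (Dealiasing.box K))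
    {t₀ : ℝ} (h0 : dyad101 (U t₀) = U t₀) (t : ℝ) : dyad101 (U t) = U t :=
  isoB.act_eq_self_box hU hs h0 t

/-- Fixed by the two generators ⇒ fixed by every word in them, i.e. by all eight elements `1, A², A, A³, AB, A³B, B, A²B`
of `P4₃2₁2(y)`: the fixed space of the group is `Fix(A) ∩ Fix(B)`. [folklore] -/
theorem fixed_words {X : FourierVelocity} (hA : screw43 X = X) (hB : dyad101 X = X) :
    screw43 (screw43 X) = X ∧ screw43 (screw43 (screw43 X)) = X ∧ screw43 (dyad101 X) = X ∧
      screw43 (screw43 (screw43 (dyad101 X))) = X ∧ screw43 (screw43 (dyad101 X)) = X := by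
  simp [hA, hB]

/-- **On the engines' mask a datum fixed by both generators stays fixed by the whole group.** [folklore] -/
theorem group_persists_box {K : ℕ} {U : ℝ → FourierVelocity} {ν : ℝ} {c : ℝ → (Fin 3 → ℤ) → ℂ}
    (hU : IsGalerkinSolution U (Dealiasing.box K) ν c fun _ _ _ => 0) (hs : IsSupportedOn U (Dealiasing.box K))
    {t₀ : ℝ} (hA : screw43 (U t₀) = U t₀) (hB : dyad101 (U t₀) = U t₀) (t : ℝ) :
    screw43 (U t) = U t ∧ dyad101 (U t) = U t :=
  ⟨screw43_persists_box hU hs hA t, dyad101_persists_box hU hs hB t⟩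

/-! ## Invariance of the quadratic diagnostics -/

/-- `E_S[screw43 X] = E_S[X]` on a mode set mapped into itself by `P_Aᵀ`. [folklore] -/
theorem truncEnergy_screw43 (X : FourierVelocity) {S : Finset (Fin 3 → ℤ)} (hS : ∀ p ∈ S, isoA.invK p ∈ S) :
    truncEnergy (screw43 X) S = truncEnergy X S :=
  isoA.truncEnergy_sg transA X hS

/-- `Z_S[screw43 X] = Z_S[X]`. [folklore] -/
theorem truncEnstrophy_screw43 (X : FourierVelocity) {S : Finset (Fin 3 → ℤ)} (hS : ∀ p ∈ S, isoA.invK p ∈ S) :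
    truncEnstrophy (screw43 X) S = truncEnstrophy X S :=
  isoA.truncEnstrophy_sg transA X hS

/-- `E_S[dyad101 X] = E_S[X]`, `Z_S[dyad101 X] = Z_S[X]` on a mode set mapped into itself by `P_B`. [folklore] -/
theorem truncEnergy_dyad101 (X : FourierVelocity) {S : Finset (Fin 3 → ℤ)} (hS : ∀ p ∈ S, isoB.invK p ∈ S) :
    truncEnergy (dyad101 X) S = truncEnergy X S ∧ truncEnstrophy (dyad101 X) S = truncEnstrophy X S :=
  ⟨isoB.truncEnergy_act X hS, isoB.truncEnstrophy_act X hS⟩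

/-! ## Selection rules on the screw axis `k = (0, k₁, 0)` -/

/-- The axis line is fixed by `P_Aᵀ`. [folklore] -/
theorem isoA_invK_axis (k₁ : ℤ) : isoA.invK ![0, k₁, 0] = ![0, k₁, 0] := by
  rw [isoA_invK]
  funext i
  fin_cases i <;> simp

/-- `k·a = 3πk₁/2` on the axis. [folklore] -/
theorem rdot_axis (k₁ : ℤ) : rdot ![0, k₁, 0] transA = (k₁ : ℝ) * (3 * Real.pi / 2) := by
  unfold rdot transA
  simp [Fin.sum_univ_three]

/-- **The invariance equations on the axis**: `û₀ = ζ û₂`, `û₁ = ζ û₁`, `û₂ = −ζ û₀` with `ζ = e^{−3πik₁/2}`. [folklore] -/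
theorem axis_equations {X : FourierVelocity} (h : screw43 X = X) (k₁ : ℤ) :
    X.coeff ![0, k₁, 0] 0 = phase transA ![0, k₁, 0] * X.coeff ![0, k₁, 0] 2 ∧
      X.coeff ![0, k₁, 0] 1 = phase transA ![0, k₁, 0] * X.coeff ![0, k₁, 0] 1 ∧
      X.coeff ![0, k₁, 0] 2 = -(phase transA ![0, k₁, 0] * X.coeff ![0, k₁, 0] 0) := by
  have e := screw43_coeff X ![0, k₁, 0]
  rw [h, isoA_invK_axis] at e
  refine ⟨?_, ?_, ?_⟩
  · exact (congrFun e 0).trans (by simp)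
  · exact (congrFun e 1).trans (by simp)
  · exact (congrFun e 2).trans (by simp)

/-- Incompressibility on the axis: `k₁ û₁ = 0`. [folklore] -/
theorem axis_divFree (X : FourierVelocity) (k₁ : ℤ) (hk : k₁ ≠ 0) : X.coeff ![0, k₁, 0] 1 = 0 := by
  have hd := X.divFree ![0, k₁, 0]
  rw [Fin.sum_univ_three] at hd
  simp only [Matrix.cons_val_zero, Matrix.cons_val_one, Matrix.head_cons, Matrix.cons_val_two, Matrix.tail_cons,
    Int.cast_zero, zero_mul, zero_add, add_zero] at hd
  rcases mul_eq_zero.mp hd with h | h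
  · exact absurd (by exact_mod_cast h) hk
  · exact h

/-- `ζ = e^{−3πi(2m)/2} = ±1` at even `k₁ = 2m`: `ζ² = 1`. [folklore] -/
theorem phase_axis_even (m : ℤ) : phase transA ![0, 2 * m, 0] = 1 ∨ phase transA ![0, 2 * m, 0] = -1 := by
  have h : rdot ![0, 2 * m, 0] transA = ((3 * m : ℤ) : ℝ) * Real.pi := by
    rw [rdot_axis]; push_cast; ring
  rcases Int.even_or_odd (3 * m) with he | ho
  · exact Or.inl (phase_eq_one_of_even h he)
  · exact Or.inr (phase_eq_neg_one_of_odd h ho)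

/-- `ζ = i` at `k₁ = 4m + 1`. [folklore] -/
theorem phase_axis_one (m : ℤ) : phase transA ![0, 4 * m + 1, 0] = I := by
  unfold phase
  rw [rdot_axis]
  have e : (((-(((4 * m + 1 : ℤ) : ℝ) * (3 * Real.pi / 2)) : ℝ)) : ℂ) * I =
      ((-(3 * m + 1) : ℤ) : ℂ) * (2 * Real.pi * I) + Real.pi / 2 * I := by
    push_cast; ring
  rw [e, Complex.exp_add, Complex.exp_int_mul_two_pi_mul_I, one_mul, Complex.exp_pi_div_two_mul_I]

/-- `ζ = −i` at `k₁ = 4m + 3`. [folklore] -/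
theorem phase_axis_three (m : ℤ) : phase transA ![0, 4 * m + 3, 0] = -I := by
  unfold phase
  rw [rdot_axis]
  have e : (((-(((4 * m + 3 : ℤ) : ℝ) * (3 * Real.pi / 2)) : ℝ)) : ℂ) * I =
      ((-(3 * m + 2) : ℤ) : ℂ) * (2 * Real.pi * I) + -(Real.pi / 2 * I) := by
    push_cast; ring
  rw [e, Complex.exp_add, Complex.exp_int_mul_two_pi_mul_I, one_mul, Complex.exp_neg, Complex.exp_pi_div_two_mul_I,
    Complex.inv_I]

/-- **EVEN AXIS MODES ARE EMPTY**: a `screw43`-invariant field has `û(0, 2m, 0) = 0` for every `m ≠ 0`. [folklore] -/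
theorem axis_even {X : FourierVelocity} (h : screw43 X = X) (m : ℤ) (hm : m ≠ 0) : X.coeff ![0, 2 * m, 0] = 0 := by
  obtain ⟨e0, -, e2⟩ := axis_equations h (2 * m)
  have h1 : X.coeff ![0, 2 * m, 0] 1 = 0 := axis_divFree X (2 * m) (by omega)
  have h0 : X.coeff ![0, 2 * m, 0] 0 = 0 := by
    rcases phase_axis_even m with hp | hp <;> rw [hp] at e0 e2
    · rw [e2] at e0; linear_combination e0 / 2
    · rw [e2] at e0; linear_combination e0 / 2
  have h2 : X.coeff ![0, 2 * m, 0] 2 = 0 := by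
    rw [e2, h0, mul_zero, neg_zero]
  funext i
  fin_cases i
  · exact h0
  · exact h1
  · exact h2

/-- **THE ZERO MODE**: `û₀(0) = û₂(0) = 0` — under the `4₃` screw alone a mean flow can only point ALONG the screw axis.
[folklore] -/
theorem axis_zero {X : FourierVelocity} (h : screw43 X = X) : X.coeff 0 0 = 0 ∧ X.coeff 0 2 = 0 := by
  have hz : (![0, 2 * 0, 0] : Fin 3 → ℤ) = 0 := by funext i; fin_cases i <;> simp
  obtain ⟨e0, -, e2⟩ := axis_equations h (2 * 0)
  rw [hz] at e0 e2
  have hp : phase transA 0 = 1 := phase_zero transA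
  rw [hp, one_mul] at e0 e2
  constructor
  · rw [e2] at e0; linear_combination e0 / 2
  · rw [e0] at e2; linear_combination e2 / 2

/-- … and the dyad `AB = 2₁ ∥ x` of the full group (`P (x,y,z) = (x, −y, −z)` up to its translation, which does not act on
`k = 0`) removes the axial mean too: **a field fixed by `screw43` and `dyad101` has zero mean flow**, `û(0) = 0`.
[folklore] -/
theorem mean_zero {X : FourierVelocity} (hA : screw43 X = X) (hB : dyad101 X = X) : X.coeff 0 = 0 := by
  obtain ⟨h0, h2⟩ := axis_zero hA
  have e := congrFun (dyad101_coeff X 0) 1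
  rw [hB] at e
  have hz : isoB.invK 0 = 0 := by rw [isoB_invK]; funext i; fin_cases i <;> simp
  rw [hz] at e
  simp only [Matrix.cons_val_one, Matrix.cons_val_zero] at e
  have h1 : X.coeff 0 1 = 0 := by linear_combination e / 2
  funext i
  fin_cases i
  · exact h0
  · exact h1
  · exact h2

/-- **`k₁ ≡ 1 (mod 4)`: `û₁ = 0` and `û₂ = −i û₀`** — a pure helical wave. [folklore] -/
theorem axis_one_mod_four {X : FourierVelocity} (h : screw43 X = X) (m : ℤ) :
    X.coeff ![0, 4 * m + 1, 0] 1 = 0 ∧ X.coeff ![0, 4 * m + 1, 0] 2 = -I * X.coeff ![0, 4 * m + 1, 0] 0 := by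
  obtain ⟨-, -, e2⟩ := axis_equations h (4 * m + 1)
  rw [phase_axis_one] at e2
  exact ⟨axis_divFree X _ (by omega), by rw [e2]; ring⟩

/-- **`k₁ ≡ 3 (mod 4)`: `û₁ = 0` and `û₂ = +i û₀`** — the opposite helical wave. [folklore] -/
theorem axis_three_mod_four {X : FourierVelocity} (h : screw43 X = X) (m : ℤ) :
    X.coeff ![0, 4 * m + 3, 0] 1 = 0 ∧ X.coeff ![0, 4 * m + 3, 0] 2 = I * X.coeff ![0, 4 * m + 3, 0] 0 := by
  obtain ⟨-, -, e2⟩ := axis_equations h (4 * m + 3)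
  rw [phase_axis_three] at e2
  exact ⟨axis_divFree X _ (by omega), by rw [e2]; ring⟩

/-- The helicity pairing on the axis for a field with `û₁ = 0` there: `Σ_j û_j conj ω̂_j = i k₁ (û₂ conj û₀ − û₀ conj û₂)`.
[folklore] -/
theorem axis_helicity_sum (X : FourierVelocity) (k₁ : ℤ) (h1 : X.coeff ![0, k₁, 0] 1 = 0) :
    ∑ j, X.coeff ![0, k₁, 0] j * conj ((curl X).coeff ![0, k₁, 0] j) =
      I * (k₁ : ℂ) * (X.coeff ![0, k₁, 0] 2 * conj (X.coeff ![0, k₁, 0] 0) -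
        X.coeff ![0, k₁, 0] 0 * conj (X.coeff ![0, k₁, 0] 2)) := by
  rw [Fin.sum_univ_three]
  simp only [curl_coeff, kcross_zero, kcross_one, kcross_two, Matrix.cons_val_zero, Matrix.cons_val_one,
    Matrix.cons_val_two, Matrix.tail_cons, Matrix.head_cons, Int.cast_zero, zero_mul, sub_zero, zero_sub, h1, map_mul,
    map_neg, Complex.conj_I, map_intCast, mul_zero, add_zero]
  ring

/-- **Helicity of a helical axis mode** `û = (u, 0, s·i·u)` at `k = (0, k₁, 0)`, `s = ±1`: `H(k) = −2 s k₁ E(k)` — the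
realizability bound `|H(k)| ≤ 2|k|E(k)` (`abs_modalHelicity_le`) SATURATED, with sign `−s·sgn k₁`. [folklore] -/
theorem helicity_of_helical (X : FourierVelocity) (k₁ : ℤ) (h1 : X.coeff ![0, k₁, 0] 1 = 0) (s : ℝ)
    (hs : s = 1 ∨ s = -1) (h2 : X.coeff ![0, k₁, 0] 2 = (s : ℂ) * I * X.coeff ![0, k₁, 0] 0) :
    modalHelicity X ![0, k₁, 0] = -(2 * s * (k₁ : ℝ)) * modalEnergy X ![0, k₁, 0] := by
  have hss : s * s = 1 := by rcases hs with rfl | rfl <;> norm_num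
  have hE : modalEnergy X ![0, k₁, 0] = Complex.normSq (X.coeff ![0, k₁, 0] 0) := by
    unfold modalEnergy
    rw [Fin.sum_univ_three, h1, h2, Complex.normSq_mul, Complex.normSq_mul, Complex.normSq_I, Complex.normSq_ofReal, hss]
    simp
    ring
  have hc : I * (k₁ : ℂ) * ((s : ℂ) * I * X.coeff ![0, k₁, 0] 0 * conj (X.coeff ![0, k₁, 0] 0) -
      X.coeff ![0, k₁, 0] 0 * conj ((s : ℂ) * I * X.coeff ![0, k₁, 0] 0)) =
      ((-(2 * s * (k₁ : ℝ)) * Complex.normSq (X.coeff ![0, k₁, 0] 0) : ℝ) : ℂ) := by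
    rw [map_mul, map_mul, Complex.conj_ofReal, Complex.conj_I]
    push_cast
    rw [Complex.normSq_eq_conj_mul_self]
    linear_combination (2 * (s : ℂ) * (k₁ : ℂ) * X.coeff ![0, k₁, 0] 0 * conj (X.coeff ![0, k₁, 0] 0)) * Complex.I_mul_I
  unfold modalHelicity
  rw [axis_helicity_sum X k₁ h1, h2, hc, Complex.ofReal_re, hE]

/-- **`H(0, k₁, 0) = +2k₁ E(0, k₁, 0)` for `k₁ ≡ 1 (mod 4)`**: the realizability bound `|H(k)| ≤ 2|k|E(k)` is SATURATED with
the positive sign (for `k₁ > 0`; `H(−k) = H(k)`). [folklore] -/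
theorem axis_helicity_one_mod_four {X : FourierVelocity} (h : screw43 X = X) (m : ℤ) :
    modalHelicity X ![0, 4 * m + 1, 0] = 2 * ((4 * m + 1 : ℤ) : ℝ) * modalEnergy X ![0, 4 * m + 1, 0] := by
  obtain ⟨h1, h2⟩ := axis_one_mod_four h m
  rw [helicity_of_helical X (4 * m + 1) h1 (-1) (Or.inr rfl) (by rw [h2]; push_cast; ring)]
  ring

/-- **`H(0, k₁, 0) = −2k₁ E(0, k₁, 0)` for `k₁ ≡ 3 (mod 4)`**: saturated with the negative sign. [folklore] -/
theorem axis_helicity_three_mod_four {X : FourierVelocity} (h : screw43 X = X) (m : ℤ) :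
    modalHelicity X ![0, 4 * m + 3, 0] = -(2 * ((4 * m + 3 : ℤ) : ℝ)) * modalEnergy X ![0, 4 * m + 3, 0] := by
  obtain ⟨h1, h2⟩ := axis_three_mod_four h m
  rw [helicity_of_helical X (4 * m + 3) h1 1 (Or.inl rfl) (by rw [h2]; push_cast; ring)]
  ring

/-! ## Along Galerkin solutions with a `screw43`-invariant datum (engines' mask) -/

/-- **Every even axis mode `(0, 2m, 0)`, `m ≠ 0`, is ZERO AT EVERY TIME** along an unforced Galerkin solution on the cubic
mask whose datum is `screw43`-invariant — an exact diagnostic for the `screw` family and `sym`-projected data.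
[folklore] -/
theorem axis_even_along {K : ℕ} {U : ℝ → FourierVelocity} {ν : ℝ} {c : ℝ → (Fin 3 → ℤ) → ℂ}
    (hU : IsGalerkinSolution U (Dealiasing.box K) ν c fun _ _ _ => 0) (hs : IsSupportedOn U (Dealiasing.box K))
    {t₀ : ℝ} (h0 : screw43 (U t₀) = U t₀) (t : ℝ) (m : ℤ) (hm : m ≠ 0) : (U t).coeff ![0, 2 * m, 0] = 0 :=
  axis_even (screw43_persists_box hU hs h0 t) m hm

/-- **The odd axis modes stay pure helical waves with the `4₃` sign pattern at every time**:
`H(0,4m+1,0)(t) = 2(4m+1)E`, `H(0,4m+3,0)(t) = −2(4m+3)E`. [folklore] -/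
theorem axis_helicity_along {K : ℕ} {U : ℝ → FourierVelocity} {ν : ℝ} {c : ℝ → (Fin 3 → ℤ) → ℂ}
    (hU : IsGalerkinSolution U (Dealiasing.box K) ν c fun _ _ _ => 0) (hs : IsSupportedOn U (Dealiasing.box K))
    {t₀ : ℝ} (h0 : screw43 (U t₀) = U t₀) (t : ℝ) (m : ℤ) :
    modalHelicity (U t) ![0, 4 * m + 1, 0] = 2 * ((4 * m + 1 : ℤ) : ℝ) * modalEnergy (U t) ![0, 4 * m + 1, 0] ∧
      modalHelicity (U t) ![0, 4 * m + 3, 0] = -(2 * ((4 * m + 3 : ℤ) : ℝ)) * modalEnergy (U t) ![0, 4 * m + 3, 0] :=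
  ⟨axis_helicity_one_mod_four (screw43_persists_box hU hs h0 t) m,
    axis_helicity_three_mod_four (screw43_persists_box hU hs h0 t) m⟩

end Summit.NavierStokesRegularity.FluidComputer.ChiralScrewGroupAction
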